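import Literature.Barriers.NavierStokesRegularity.BuckmasterVicolNonuniquenessLimit
import Literature.Analysis.FluidPDE.FractionalNSReynoldsWeakIdentity
import Literature.Analysis.FunctionSpaces.TorusLerayHelmholtzSpaceTime
import HarnessLib

/-!
# Luo–Titi 2020, Theorem 1 — proof architecture, II: the `L^∞_t L²_x` limit of the iteration

Sibling proof file of the barrier entry
`Literature/Barriers/NavierStokesRegularity/LionsExponentSharpness` (D-0021). T. Luo, E. S. Titi,
Calc. Var. PDE 59 (2020) = arXiv:1808.07595, §2.1, proof of Theorem 1: "It follows from (2.4) that
`∑ ‖v_{q+1} - v_q‖_{L^∞_t L²_x} ≤ C ∑ δ_{q+1}^{1/2} < ∞`. Thus `v_q` converge strongly to some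
`v ∈ C⁰_t L²_x`. Since `‖R_{q+1}‖_{L^∞_t L¹_x} → 0`, as `q → ∞`, `v` is a weak solution to the
FVNSE (1.1)." This file proves that sentence on the tree's unit torus `T^d`, for smooth solutions
`(v_q, p_q, R_q)` of the fractional Navier–Stokes–Reynolds system on `ℝ × T^d`
(`Torus.IsFracNSReynoldsOn univ`, `FluidPDE/FractionalNSReynolds`) with velocities supported in a
fixed compact time interval, stresses `‖R_q‖_{L^∞_t L¹_x} → 0`, and summable increments
`sup_t ‖v_{q+1}(t) - v_q(t)‖_{L²} ≤ ε_q`, `∑ ε_q < ∞`: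

* `exists_isWeakFracNSSolutionLine_of_summable` — the pointwise a.e. limit
  `v(t, x) = lim_q v_q(t, x)` is a weak solution on the line in the sense of Luo–Titi's Def. 1.1
  (`Torus.IsWeakFracNSSolutionLine`, `FluidPDE/FractionalNSTorus`: jointly measurable, every slice
  in `L²`, weakly continuous in time, weakly divergence free, and the weak momentum identity
  against smooth divergence-free test fields with compact time support), it vanishes outside the
  common time support, `‖v(t) - v_q(t)‖_{L²} ≤ ∑_{i ≥ q} ε_i` for every `t`, and `v_q(t) → v(t)`
  a.e. for every `t`.

Ingredients: the `L²`-Cauchy bookkeeping of `BuckmasterVicolNonuniquenessLimit`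
(`ae_tendsto_limUnder_of_tsum_eLpNorm_ne_top`, `eLpNorm_limUnder_sub_le_tsum`), joint
measurability of the pointwise `limUnder` (Mathlib `StronglyMeasurable.limUnder`), the weak
identity with Reynolds defect `Torus.IsFracNSReynoldsOn.weak_identity_line`
(`FractionalNSReynoldsWeakIdentity`), and, for the passage to the limit in the weak momentum
identity at fixed viscosity, dominated convergence in time of the slice integrals, whose
convergence at each time is the Cauchy–Schwarz bookkeeping `Torus.lintegral_enorm_momentumFlux_sub_le`
of `DuchonRobertInviscidLimit` (the hyperviscous term `-ν⟪v, (-Δ)^θψ⟫` being absorbed into the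
linear term).

## References

* T. Luo, E. S. Titi, Calc. Var. PDE 59 (2020), Paper 92 = arXiv:1808.07595, §1 Def. 1.1, §2.1
  proof of Theorem 1. [`LuoTiti2020`]
* T. Buckmaster, V. Vicol, Ann. of Math. 189 (2019), §2.4 (the same limit step for
  Navier–Stokes). [`BuckmasterVicol2019AnnMath`]
-/

noncomputable section

open MeasureTheory Set Filter Function UnitAddTorus
open scoped ENNReal NNReal InnerProductSpace Topology ContDiff

namespace Literature.Barriers.NavierStokesRegularity

open Literature.Analysis.FunctionSpaces Literature.Analysis.FluidPDE

variable {d : Type*} [Fintype d]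

/-! ## Pairings of `L²` fields on the torus -/

section Pairing

/-- Cauchy–Schwarz for the pairing of two fields on `T^d`:
`‖∫ ⟪w, φ⟫‖ ≤ ‖w‖_{L²} ‖φ‖_{L²}` (in `[0, ∞]`). [folklore] -/
theorem enorm_integral_inner_le_eLpNorm_mul {w φ : UnitAddTorus d → EuclideanSpace ℝ d}
    (hw : AEStronglyMeasurable w volume) (hφ : AEStronglyMeasurable φ volume) :
    ‖∫ x, ⟪w x, φ x⟫_ℝ‖ₑ ≤ eLpNorm w 2 volume * eLpNorm φ 2 volume := by
  have h1 : ‖∫ x, ⟪w x, φ x⟫_ℝ‖ₑ ≤ ∫⁻ x, ‖w x‖ₑ * ‖φ x‖ₑ := by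
    refine (enorm_integral_le_lintegral_enorm _).trans (lintegral_mono fun x => ?_)
    rw [← ofReal_norm, ← ofReal_norm, ← ofReal_norm, ← ENNReal.ofReal_mul (norm_nonneg _)]
    exact ENNReal.ofReal_le_ofReal (norm_inner_le_norm _ _)
  have h2 : ∫⁻ x, ‖w x‖ₑ * ‖φ x‖ₑ ≤
      (∫⁻ x, ‖w x‖ₑ ^ 2) ^ (1 / 2 : ℝ) * (∫⁻ x, ‖φ x‖ₑ ^ 2) ^ (1 / 2 : ℝ) := by
    have h := ENNReal.lintegral_mul_le_Lp_mul_Lq volume Real.HolderConjugate.two_two hw.enorm hφ.enorm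
    simpa only [Pi.mul_apply, ENNReal.rpow_two, one_div] using h
  have h3 : ∀ f : UnitAddTorus d → EuclideanSpace ℝ d,
      (∫⁻ x, ‖f x‖ₑ ^ 2) ^ (1 / 2 : ℝ) = eLpNorm f 2 volume := fun f => by
    rw [← eLpNorm_two_sq_eq_lintegral, one_div, ← ENNReal.rpow_natCast, ← ENNReal.rpow_mul]
    norm_num
  rw [← h3 w, ← h3 φ]
  exact h1.trans h2

/-- The pairing `⟪f, g⟫` of two `L²` fields is integrable. [folklore] -/
theorem integrable_inner_of_memLp {f g : UnitAddTorus d → EuclideanSpace ℝ d}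
    (hf : MemLp f 2 volume) (hg : MemLp g 2 volume) :
    Integrable (fun x => ⟪f x, g x⟫_ℝ) volume := by
  refine Integrable.mono' (hf.norm.integrable_mul hg.norm) (hf.1.inner hg.1)
    (ae_of_all _ fun x => ?_)
  simpa only [Pi.mul_apply, Real.norm_eq_abs] using abs_real_inner_le_norm (f x) (g x)

/-- **Pairings converge under `L²` convergence**: if `‖a_q - b‖_{L²} → 0` (all in `L²`) then
`∫ ⟪a_q, φ⟫ → ∫ ⟪b, φ⟫` for every `φ ∈ L²`. [folklore] -/
theorem tendsto_integral_inner_of_tendsto_eLpNorm {a : ℕ → UnitAddTorus d → EuclideanSpace ℝ d}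
    {b φ : UnitAddTorus d → EuclideanSpace ℝ d} (ha : ∀ q, MemLp (a q) 2 volume)
    (hb : MemLp b 2 volume) (hφ : MemLp φ 2 volume)
    (h : Tendsto (fun q => eLpNorm (a q - b) 2 volume) atTop (𝓝 0)) :
    Tendsto (fun q => ∫ x, ⟪a q x, φ x⟫_ℝ) atTop (𝓝 (∫ x, ⟪b x, φ x⟫_ℝ)) := by
  rw [tendsto_iff_edist_tendsto_0]
  have hlim : Tendsto (fun q => eLpNorm (a q - b) 2 volume * eLpNorm φ 2 volume) atTop (𝓝 0) := by
    have h' := ENNReal.Tendsto.mul_const h (Or.inr hφ.eLpNorm_ne_top)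
    rwa [zero_mul] at h'
  refine tendsto_of_tendsto_of_tendsto_of_le_of_le' tendsto_const_nhds hlim
    (Eventually.of_forall fun q => zero_le) (Eventually.of_forall fun q => ?_)
  rw [edist_eq_enorm_sub, ← integral_sub (integrable_inner_of_memLp (ha q) hφ)
    (integrable_inner_of_memLp hb hφ)]
  have hfun : (fun x => ⟪a q x, φ x⟫_ℝ - ⟪b x, φ x⟫_ℝ) = fun x => ⟪(a q - b) x, φ x⟫_ℝ := by
    funext x
    rw [Pi.sub_apply, inner_sub_left]
  rw [hfun]
  exact enorm_integral_inner_le_eLpNorm_mul ((ha q).1.sub hb.1) hφ.1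

/-- **Continuity in time of the pairing with a fixed `L²` field** for a field with continuous,
bounded space–time lift: `t ↦ ∫ ⟪v(t), φ⟫` is continuous (dominated convergence with the
bound `M ‖φ‖ ∈ L¹`). [folklore] -/
theorem continuous_integral_inner_of_continuous_stLift {v : ℝ → UnitAddTorus d → EuclideanSpace ℝ d}
    (hv : Continuous (Torus.stLift v)) {M : ℝ} (hM : ∀ t x, ‖v t x‖ ≤ M)
    {φ : UnitAddTorus d → EuclideanSpace ℝ d} (hφ : MemLp φ 2 volume) :
    Continuous fun t => ∫ x, ⟪v t x, φ x⟫_ℝ := by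
  have hvu : Continuous (uncurry v) := Torus.continuous_uncurry_of_continuous_stLift hv
  have hslice : ∀ t, Continuous (v t) := fun t => hvu.comp (Continuous.prodMk_right t)
  have hφ1 : Integrable φ volume := hφ.integrable one_le_two
  refine continuous_of_dominated (bound := fun x => M * ‖φ x‖) (fun t => ?_) (fun t => ?_)
    (hφ1.norm.const_mul M) ?_
  · exact (hslice t).aestronglyMeasurable.inner hφ.1
  · exact ae_of_all _ fun x => (norm_inner_le_norm _ _).trans
      (mul_le_mul_of_nonneg_right (hM t x) (norm_nonneg _))
  · refine ae_of_all _ fun x => ?_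
    have hx : Continuous fun t => v t x := hvu.comp (continuous_id.prodMk continuous_const)
    exact hx.inner continuous_const

end Pairing

/-! ## The weak momentum integrand on one time slice -/

section Flux

/-- The weak momentum integrand of an `L²` slice against bounded continuous coefficients is
integrable: `|⟪a, δ⟫ + ⟪a, B a⟫| ≤ C_δ ‖a‖ + C_B ‖a‖²`. (The dummy third term `0·⟪a, 0⟫` keeps
the shape of `Torus.lintegral_enorm_momentumFlux_sub_le`.) [folklore] -/
theorem integrable_flux {a δ : UnitAddTorus d → EuclideanSpace ℝ d}
    {B : UnitAddTorus d → (EuclideanSpace ℝ d) →L[ℝ] EuclideanSpace ℝ d}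
    (ha : MemLp a 2 volume) (hδ : Continuous δ) (hB : Continuous B) {Cδ CB : ℝ}
    (hCδ : ∀ x, ‖δ x‖ ≤ Cδ) (hCB : ∀ x, ‖B x‖ ≤ CB) :
    Integrable (fun x => ⟪a x, δ x⟫_ℝ + ⟪a x, B x (a x)⟫_ℝ + 0 * ⟪a x, (0 : EuclideanSpace ℝ d)⟫_ℝ)
      volume := by
  have I1 : Integrable (fun x => ‖a x‖) volume := (ha.integrable one_le_two).norm
  have I2 : Integrable (fun x => ‖a x‖ ^ 2) volume := (memLp_two_iff_integrable_sq_norm ha.1).1 ha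
  have hBa : AEStronglyMeasurable (fun x => B x (a x)) volume :=
    (show Continuous (fun p : ((EuclideanSpace ℝ d) →L[ℝ] EuclideanSpace ℝ d) × EuclideanSpace ℝ d =>
        p.1 p.2) from
      isBoundedBilinearMap_apply.continuous).comp_aestronglyMeasurable₂ hB.aestronglyMeasurable ha.1
  have hmeas : AEStronglyMeasurable
      (fun x => ⟪a x, δ x⟫_ℝ + ⟪a x, B x (a x)⟫_ℝ + 0 * ⟪a x, (0 : EuclideanSpace ℝ d)⟫_ℝ) volume :=
    ((ha.1.inner hδ.aestronglyMeasurable).add (ha.1.inner hBa)).add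
      (aestronglyMeasurable_const.mul (ha.1.inner aestronglyMeasurable_const))
  refine Integrable.mono' ((I1.const_mul Cδ).add (I2.const_mul CB)) hmeas (ae_of_all _ fun x => ?_)
  have ha0 : 0 ≤ ‖a x‖ := norm_nonneg _
  have k1 : |⟪a x, δ x⟫_ℝ| ≤ Cδ * ‖a x‖ := by
    rw [mul_comm]
    exact (abs_real_inner_le_norm _ _).trans (mul_le_mul_of_nonneg_left (hCδ x) ha0)
  have k2 : |⟪a x, B x (a x)⟫_ℝ| ≤ CB * ‖a x‖ ^ 2 := by
    refine (abs_real_inner_le_norm _ _).trans ?_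
    calc ‖a x‖ * ‖B x (a x)‖ ≤ ‖a x‖ * (CB * ‖a x‖) :=
          mul_le_mul_of_nonneg_left (((B x).le_opNorm (a x)).trans
            (mul_le_mul_of_nonneg_right (hCB x) ha0)) ha0
      _ = CB * ‖a x‖ ^ 2 := by ring
  rw [Real.norm_eq_abs]
  simp only [inner_zero_right, mul_zero, add_zero, Pi.add_apply]
  exact (abs_add_le _ _).trans (add_le_add k1 k2)

/-- `momentumBound` is monotone in the distance argument `A`. [folklore] -/
theorem momentumBound_mono {c₁ c₂ c₃ n N M A A' : ℝ≥0∞} (h : A ≤ A') :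
    Torus.momentumBound c₁ c₂ c₃ n A N M ≤ Torus.momentumBound c₁ c₂ c₃ n A' N M := by
  unfold Torus.momentumBound
  gcongr

/-- `momentumBound` is finite on finite arguments. [folklore] -/
theorem momentumBound_ne_top {c₁ c₂ c₃ n N M A : ℝ≥0∞} (hc₁ : c₁ ≠ ⊤) (hc₂ : c₂ ≠ ⊤)
    (hc₃ : c₃ ≠ ⊤) (hn : n ≠ ⊤) (hN : N ≠ ⊤) (hM : M ≠ ⊤) (hA : A ≠ ⊤) :
    Torus.momentumBound c₁ c₂ c₃ n A N M ≠ ⊤ := by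
  have hA2 : A ^ (1 / 2 : ℝ) ≠ ⊤ := ENNReal.rpow_ne_top_of_nonneg (by norm_num) hA
  have hN2 : N ^ (1 / 2 : ℝ) ≠ ⊤ := ENNReal.rpow_ne_top_of_nonneg (by norm_num) hN
  have hM2 : M ^ (1 / 2 : ℝ) ≠ ⊤ := ENNReal.rpow_ne_top_of_nonneg (by norm_num) hM
  unfold Torus.momentumBound
  apply_rules [ENNReal.add_ne_top.2, And.intro, ENNReal.mul_ne_top, ENNReal.ofNat_ne_top]

/-- **`L¹` size of the weak momentum integrand of an `L²` slice**:
`‖∫ (⟪a, δ⟫ + ⟪a, B a⟫)‖ ≤ momentumBound C_δ C_B 0 0 (∫|a|²) 0 1 = C_δ ‖a‖_{L²} + C_B ‖a‖²_{L²}`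
(`Torus.lintegral_enorm_momentumFlux_sub_le` against the zero field). [folklore] -/
theorem enorm_integral_flux_le {a δ : UnitAddTorus d → EuclideanSpace ℝ d}
    {B : UnitAddTorus d → (EuclideanSpace ℝ d) →L[ℝ] EuclideanSpace ℝ d}
    (ha : AEStronglyMeasurable a volume) {Cδ CB : ℝ} (hCδ : ∀ x, ‖δ x‖ ≤ Cδ)
    (hCB : ∀ x, ‖B x‖ ≤ CB) :
    ‖∫ x, (⟪a x, δ x⟫_ℝ + ⟪a x, B x (a x)⟫_ℝ + 0 * ⟪a x, (0 : EuclideanSpace ℝ d)⟫_ℝ)‖ₑ ≤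
      Torus.momentumBound (ENNReal.ofReal Cδ) (ENNReal.ofReal CB) (ENNReal.ofReal 0) 0
        (∫⁻ x, ‖a x‖ₑ ^ 2) 0 1 := by
  have hkey := Torus.lintegral_enorm_momentumFlux_sub_le (volume : Measure (UnitAddTorus d)) (0 : ℝ)
    (a := a) (b := fun _ => (0 : EuclideanSpace ℝ d)) (δ := δ)
    (L := fun _ => (0 : EuclideanSpace ℝ d)) (B := B)
    (Cδ := Cδ) (CB := CB) (CL := 0)
    (ae_of_all _ hCδ) (ae_of_all _ hCB) (ae_of_all _ fun _ => le_of_eq norm_zero)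
    (by simpa only [sub_zero] using ha.enorm) (by simpa only [enorm_zero] using aemeasurable_const)
  simp only [sub_zero, inner_zero_left, map_zero, inner_zero_right, mul_zero, add_zero,
    enorm_zero, zero_pow two_ne_zero, lintegral_zero, measure_univ] at hkey
  refine (enorm_integral_le_lintegral_enorm _).trans ?_
  simpa only [inner_zero_right, mul_zero, add_zero] using hkey

/-- **The weak momentum integrand is continuous along `L²` convergence of the slice**: if
`a_q → b` in `L²(T^d)` (all in `L²`) then `∫ (⟪a_q, δ⟫ + ⟪a_q, B a_q⟫) → ∫ (⟪b, δ⟫ + ⟪b, B b⟫)`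
for bounded continuous `δ`, `B` (`Torus.lintegral_enorm_momentumFlux_sub_le` and
`Torus.tendsto_momentumBound`). [folklore] -/
theorem tendsto_integral_flux {a : ℕ → UnitAddTorus d → EuclideanSpace ℝ d}
    {b δ : UnitAddTorus d → EuclideanSpace ℝ d}
    {B : UnitAddTorus d → (EuclideanSpace ℝ d) →L[ℝ] EuclideanSpace ℝ d}
    (ha : ∀ q, MemLp (a q) 2 volume) (hb : MemLp b 2 volume)
    (hδ : Continuous δ) (hB : Continuous B) {Cδ CB : ℝ} (hCδ : ∀ x, ‖δ x‖ ≤ Cδ)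
    (hCB : ∀ x, ‖B x‖ ≤ CB) (h : Tendsto (fun q => eLpNorm (a q - b) 2 volume) atTop (𝓝 0)) :
    Tendsto (fun q => ∫ x,
        (⟪a q x, δ x⟫_ℝ + ⟪a q x, B x (a q x)⟫_ℝ + 0 * ⟪a q x, (0 : EuclideanSpace ℝ d)⟫_ℝ))
      atTop (𝓝 (∫ x,
        (⟪b x, δ x⟫_ℝ + ⟪b x, B x (b x)⟫_ℝ + 0 * ⟪b x, (0 : EuclideanSpace ℝ d)⟫_ℝ))) := by
  refine tendsto_integral_of_L1 _ (integrable_flux hb hδ hB hCδ hCB).aestronglyMeasurable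
    (Eventually.of_forall fun q => integrable_flux (ha q) hδ hB hCδ hCB) ?_
  have hA : Tendsto (fun q => ∫⁻ x, ‖a q x - b x‖ₑ ^ 2) atTop (𝓝 0) := by
    have h2 := ENNReal.Tendsto.pow (n := 2) h
    rw [zero_pow two_ne_zero] at h2
    refine h2.congr fun q => ?_
    rw [eLpNorm_two_sq_eq_lintegral]
    rfl
  have hN : ∫⁻ x, ‖b x‖ₑ ^ 2 ≠ ⊤ := by
    rw [← eLpNorm_two_sq_eq_lintegral]
    exact (ENNReal.pow_lt_top hb.eLpNorm_lt_top).ne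
  have hlim := Torus.tendsto_momentumBound (c₁ := ENNReal.ofReal Cδ) (c₂ := ENNReal.ofReal CB)
    (c₃ := ENNReal.ofReal 0) ENNReal.ofReal_ne_top ENNReal.ofReal_ne_top ENNReal.ofReal_ne_top
    hN (measure_ne_top (volume : Measure (UnitAddTorus d)) univ) hA
    (tendsto_const_nhds (x := (0 : ℝ≥0∞)))
  refine tendsto_of_tendsto_of_tendsto_of_le_of_le' tendsto_const_nhds hlim
    (Eventually.of_forall fun _ => zero_le) (Eventually.of_forall fun q => ?_)
  have hkey := Torus.lintegral_enorm_momentumFlux_sub_le (volume : Measure (UnitAddTorus d)) (0 : ℝ)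
    (a := a q) (b := b) (δ := δ) (L := fun _ => (0 : EuclideanSpace ℝ d)) (B := B) (Cδ := Cδ)
    (CB := CB) (CL := 0)
    (ae_of_all _ hCδ) (ae_of_all _ hCB) (ae_of_all _ fun _ => le_of_eq norm_zero)
    ((ha q).1.sub hb.1).enorm hb.1.enorm
  rw [enorm_zero] at hkey
  exact hkey

end Flux

/-! ## The limit of the iteration is a weak solution on the line -/

section Limit

omit [Fintype d] in
/-- A field with continuous space–time lift vanishing off a compact time interval is bounded.
[folklore] -/
theorem exists_forall_norm_le_of_support {F : Type*} [NormedAddCommGroup F]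
    {u : ℝ → UnitAddTorus d → F} (hu : Continuous (Torus.stLift u)) {A B : ℝ}
    (h0 : ∀ t ∉ Icc A B, u t = 0) : ∃ C : ℝ, 0 ≤ C ∧ ∀ t x, ‖u t x‖ ≤ C := by
  obtain ⟨C, hC⟩ := Torus.exists_norm_le_of_continuousOn_of_isCompact (S := univ)
    hu.continuousOn isCompact_Icc (subset_univ (Icc A B))
  refine ⟨max C 0, le_max_right _ _, fun t x => ?_⟩
  by_cases ht : t ∈ Icc A B
  · exact (hC t ht x).trans (le_max_left _ _)
  · rw [h0 t ht]
    simp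

/-- On the probability space `T^d`, `‖f‖_{L²} ≤ C` as soon as `‖f x‖ ≤ C` for all `x`.
[folklore] -/
theorem eLpNorm_le_ofReal_of_forall_norm_le {F : Type*} [NormedAddCommGroup F]
    {f : UnitAddTorus d → F} {C : ℝ} (h : ∀ x, ‖f x‖ ≤ C) :
    eLpNorm f 2 volume ≤ ENNReal.ofReal C := by
  have h1 := eLpNorm_le_of_ae_bound (p := 2) (μ := (volume : Measure (UnitAddTorus d)))
    (Eventually.of_forall h)
  simpa using h1

variable [DecidableEq d]

/-- **The `L^∞_t L²_x` limit of Luo–Titi's iteration is a weak solution** (Luo–Titi 2020, §2.1,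
proof of Theorem 1: "`v_q` converge strongly to some `v ∈ C⁰_tL²_x`. Since
`‖R_{q+1}‖_{L^∞_tL¹_x} → 0` … `v` is a weak solution to the FVNSE"). Let `(v_q, p_q, R_q)` be smooth
solutions of the fractional Navier–Stokes–Reynolds system on `ℝ × T^d` (`θ ≥ 0`, fixed `ν`) with
`v_q(t) = 0` for `t ∉ [A, B]`, `sup_t ∫‖R_q(t)‖ ≤ η_q → 0`, and
`sup_t ‖v_{q+1}(t) - v_q(t)‖_{L²} ≤ ε_q` with `∑ ε_q < ∞`. Then the pointwise limit
`v(t, x) = lim_q v_q(t, x)` (which exists for a.e. `x`, for every `t`) is a weak solution on the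
line in the sense of Luo–Titi's Def. 1.1 (`Torus.IsWeakFracNSSolutionLine θ ν v`), vanishes for
`t ∉ [A, B]`, and `‖v(t) - v_q(t)‖_{L²} ≤ ∑_{i ≥ q} ε_i` for all `t`, `q`. Proof: joint
measurability of the pointwise `limUnder`; `L²` tail bounds by Fatou; weak continuity in time as a
uniform limit of continuous pairings; weak incompressibility slice by slice; and the weak momentum
identity from `Torus.IsFracNSReynoldsOn.weak_identity_line` (defect `∫∫ R_q : ∇ψ = O(η_q)`) by
dominated convergence in time of the slice integrals (`tendsto_integral_flux`, uniform `L²`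
bounds `‖v_q(t)‖_{L²} ≤ sup|v_0| + ∑ε`). [cite: LuoTiti2020, §2.1, proof of Theorem 1] -/
theorem exists_isWeakFracNSSolutionLine_of_summable {θ ν : ℝ} (hθ : 0 ≤ θ)
    {v : ℕ → ℝ → UnitAddTorus d → EuclideanSpace ℝ d} {p : ℕ → ℝ → UnitAddTorus d → ℝ}
    {R : ℕ → ℝ → UnitAddTorus d → d → EuclideanSpace ℝ d}
    (hsol : ∀ q, Torus.IsFracNSReynoldsOn univ θ ν (v q) (p q) (R q))
    {A B : ℝ} (hsupp : ∀ q t, t ∉ Icc A B → v q t = 0)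
    {η : ℕ → ℝ} (hR : ∀ q t, ∫ x, ‖R q t x‖ ≤ η q) (hη : Tendsto η atTop (𝓝 0))
    {ε : ℕ → ℝ≥0∞} (hinc : ∀ q t, eLpNorm (v (q + 1) t - v q t) 2 volume ≤ ε q)
    (hε : ∑' q, ε q ≠ ⊤) :
    ∃ w : ℝ → UnitAddTorus d → EuclideanSpace ℝ d,
      Torus.IsWeakFracNSSolutionLine θ ν w ∧ (∀ t ∉ Icc A B, w t = 0) ∧
      (∀ q t, eLpNorm (w t - v q t) 2 volume ≤ ∑' i, ε (q + i)) ∧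
      ∀ t, ∀ᵐ x, Tendsto (fun q => v q t x) atTop (𝓝 (w t x)) := by
  -- smoothness bookkeeping
  have hsm : ∀ q, Torus.IsSmoothSpaceTimeOn univ (v q) := fun q => (hsol q).smooth_velocity
  have hcont : ∀ q, Continuous (Torus.stLift (v q)) := fun q => by
    have h := hsm q
    rw [Torus.IsSmoothSpaceTimeOn, univ_prod_univ, contDiffOn_univ] at h
    exact h.continuous
  have hvs : ∀ q t, Torus.IsSmooth (v q t) := fun q t => (hsm q).isSmooth_slice (mem_univ t)
  have hmeas : ∀ q t, AEStronglyMeasurable (v q t) volume := fun q t =>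
    (hvs q t).continuous.aestronglyMeasurable
  have hL2 : ∀ q t, MemLp (v q t) 2 volume := fun q t => (hvs q t).memLp 2
  -- the pointwise limit
  set w : ℝ → UnitAddTorus d → EuclideanSpace ℝ d := fun t x => limUnder atTop fun q => v q t x
    with hw_def
  have hsum_t : ∀ t, ∑' q, eLpNorm (v (q + 1) t - v q t) 2 volume ≠ ⊤ := fun t =>
    ne_top_of_le_ne_top hε (ENNReal.tsum_le_tsum fun q => hinc q t)
  have hae : ∀ t, ∀ᵐ x, Tendsto (fun q => v q t x) atTop (𝓝 (w t x)) := fun t =>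
    ae_tendsto_limUnder_of_tsum_eLpNorm_ne_top (fun q => hmeas q t) (hsum_t t)
  have htail : ∀ q t, eLpNorm (w t - v q t) 2 volume ≤ ∑' i, ε (q + i) := fun q t =>
    eLpNorm_limUnder_sub_le_tsum (fun n => hmeas n t) (fun n => hinc n t) hε q
  have hwm : ∀ t, AEStronglyMeasurable (w t) volume := fun t =>
    aestronglyMeasurable_of_tendsto_ae atTop (fun q => hmeas q t) (hae t)
  have htail0 : Tendsto (fun q => ∑' i, ε (q + i)) atTop (𝓝 0) := by
    refine (ENNReal.tendsto_sum_nat_add ε hε).congr fun q => tsum_congr fun i => ?_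
    rw [add_comm]
  have hconv : ∀ t, Tendsto (fun q => eLpNorm (v q t - w t) 2 volume) atTop (𝓝 0) := fun t =>
    tendsto_of_tendsto_of_tendsto_of_le_of_le' tendsto_const_nhds htail0
      (Eventually.of_forall fun _ => zero_le) (Eventually.of_forall fun q => by
        rw [← eLpNorm_neg, neg_sub]; exact htail q t)
  have hS0 : ∑' i, ε (0 + i) = ∑' i, ε i := tsum_congr fun i => by rw [zero_add]
  have hwv0 : ∀ t, MemLp (w t - v 0 t) 2 volume := fun t =>
    ⟨(hwm t).sub (hmeas 0 t), (htail 0 t).trans_lt (by rw [hS0]; exact hε.lt_top)⟩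
  have hwL2 : ∀ t, MemLp (w t) 2 volume := fun t => by
    have h := (hwv0 t).add (hL2 0 t)
    rwa [sub_add_cancel] at h
  -- temporal support
  have hw0 : ∀ t ∉ Icc A B, w t = 0 := fun t ht => by
    funext x
    change limUnder atTop (fun q => v q t x) = 0
    have h : (fun q => v q t x) = fun _ => (0 : EuclideanSpace ℝ d) :=
      funext fun q => by rw [hsupp q t ht]; rfl
    rw [h]
    exact tendsto_const_nhds.limUnder_eq
  -- uniform `L²` bounds
  obtain ⟨M₀, hM₀0, hM₀⟩ := exists_forall_norm_le_of_support (hcont 0) (hsupp 0)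
  set S : ℝ≥0∞ := ∑' q, ε q with hS_def
  set Mtot : ℝ≥0∞ := ENNReal.ofReal M₀ + S with hMtot_def
  have hMtot : Mtot ≠ ⊤ := ENNReal.add_ne_top.2 ⟨ENNReal.ofReal_ne_top, hε⟩
  have hv0b : ∀ t, eLpNorm (v 0 t) 2 volume ≤ ENNReal.ofReal M₀ := fun t =>
    eLpNorm_le_ofReal_of_forall_norm_le (hM₀ t)
  have hvb : ∀ q t, eLpNorm (v q t) 2 volume ≤ Mtot := fun q t => by
    have h1 : eLpNorm (v q t - v 0 t) 2 volume ≤ S := by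
      refine (eLpNorm_sub_le_tsum_of_le (fun n => hmeas n t) (fun n => hinc n t)
        (Nat.zero_le q)).trans ?_
      rw [hS0]
    calc eLpNorm (v q t) 2 volume = eLpNorm ((v q t - v 0 t) + v 0 t) 2 volume := by
          rw [sub_add_cancel]
      _ ≤ eLpNorm (v q t - v 0 t) 2 volume + eLpNorm (v 0 t) 2 volume :=
          eLpNorm_add_le ((hmeas q t).sub (hmeas 0 t)) (hmeas 0 t) one_le_two
      _ ≤ S + ENNReal.ofReal M₀ := add_le_add h1 (hv0b t)
      _ = Mtot := add_comm _ _
  have hwb : ∀ t, eLpNorm (w t) 2 volume ≤ Mtot := fun t => by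
    have h1 : eLpNorm (w t - v 0 t) 2 volume ≤ S := (htail 0 t).trans (by rw [hS0])
    calc eLpNorm (w t) 2 volume = eLpNorm ((w t - v 0 t) + v 0 t) 2 volume := by
          rw [sub_add_cancel]
      _ ≤ eLpNorm (w t - v 0 t) 2 volume + eLpNorm (v 0 t) 2 volume :=
          eLpNorm_add_le ((hwm t).sub (hmeas 0 t)) (hmeas 0 t) one_le_two
      _ ≤ S + ENNReal.ofReal M₀ := add_le_add h1 (hv0b t)
      _ = Mtot := add_comm _ _
  refine ⟨w, ⟨?_, hwL2, ?_, ?_, ?_⟩, hw0, htail, hae⟩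
  · -- joint measurability
    have h : Torus.stLift w = fun z => limUnder atTop (fun q => Torus.stLift (v q) z) := rfl
    rw [h]
    exact (StronglyMeasurable.limUnder (l := atTop)
      (fun q => (hcont q).stronglyMeasurable)).aestronglyMeasurable
  · -- weak continuity in time
    intro φ hφ
    have hg : ∀ q, Continuous fun t => ∫ x, ⟪v q t x, φ x⟫_ℝ := fun q => by
      obtain ⟨Mq, -, hMq⟩ := exists_forall_norm_le_of_support (hcont q) (hsupp q)
      exact continuous_integral_inner_of_continuous_stLift (hcont q) hMq hφ
    have hkey : ∀ q t, ‖(∫ x, ⟪v q t x, φ x⟫_ℝ) - ∫ x, ⟪w t x, φ x⟫_ℝ‖ₑ ≤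
        (∑' i, ε (q + i)) * eLpNorm φ 2 volume := fun q t => by
      rw [← integral_sub (integrable_inner_of_memLp (hL2 q t) hφ)
        (integrable_inner_of_memLp (hwL2 t) hφ)]
      have hfun : (fun x => ⟪v q t x, φ x⟫_ℝ - ⟪w t x, φ x⟫_ℝ) =
          fun x => ⟪(v q t - w t) x, φ x⟫_ℝ := by
        funext x
        rw [Pi.sub_apply, inner_sub_left]
      rw [hfun]
      refine (enorm_integral_inner_le_eLpNorm_mul ((hmeas q t).sub (hwm t)) hφ.1).trans ?_
      gcongr
      rw [← eLpNorm_neg, neg_sub]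
      exact htail q t
    have hunif : TendstoUniformly (fun q t => ∫ x, ⟪v q t x, φ x⟫_ℝ)
        (fun t => ∫ x, ⟪w t x, φ x⟫_ℝ) atTop := by
      rw [Metric.tendstoUniformly_iff]
      intro r hr
      have hlim : Tendsto (fun q => (∑' i, ε (q + i)) * eLpNorm φ 2 volume) atTop (𝓝 0) := by
        have h' := ENNReal.Tendsto.mul_const htail0 (Or.inr hφ.eLpNorm_ne_top)
        rwa [zero_mul] at h'
      have hev : ∀ᶠ q in atTop, (∑' i, ε (q + i)) * eLpNorm φ 2 volume < ENNReal.ofReal r :=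
        (tendsto_order.1 hlim).2 _ (ENNReal.ofReal_pos.2 hr)
      filter_upwards [hev] with q hq t
      rw [dist_comm, dist_eq_norm]
      have h1 := (hkey q t).trans_lt hq
      rw [← ofReal_norm, ENNReal.ofReal_lt_ofReal_iff hr] at h1
      exact h1
    exact hunif.continuous (Eventually.of_forall hg).frequently
  · -- weakly divergence free at every time
    intro t θ' hθ'
    have hq0 : ∀ q, ∫ x, ⟪v q t x, Torus.gradient θ' x⟫_ℝ = 0 := fun q =>
      Torus.IsDivFree.isWeaklyDivFree_holds (hvs q t) ((hsol q).divFree t (mem_univ t)) θ' hθ'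
    have hlim := tendsto_integral_inner_of_tendsto_eLpNorm (fun q => hL2 q t) (hwL2 t)
      (hθ'.gradient.memLp 2) (hconv t)
    simp_rw [hq0] at hlim
    exact (tendsto_nhds_unique tendsto_const_nhds hlim).symm
  · -- the weak momentum identity
    intro ψ hψ hab hψdiv
    obtain ⟨a₁, b₁, hab⟩ := hab
    -- smooth data derived from the test field
    have hψs : Torus.IsSmoothSpaceTimeOn univ ψ := Torus.isSmoothSpaceTimeOn_of_contDiff hψ univ
    have hψ' : Torus.IsSmoothSpaceTimeOn univ (Torus.timeDeriv ψ) := hψs.timeDeriv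
    have hψt : ∀ t, Torus.IsSmooth (ψ t) := fun t => hψs.isSmooth_slice (mem_univ t)
    have hψ't : ∀ t, Torus.IsSmooth (Torus.timeDeriv ψ t) := fun t => hψ'.isSmooth_slice (mem_univ t)
    have hΛc : ∀ t, Continuous (Torus.fracLaplacian θ (ψ t)) := fun t =>
      Torus.continuous_fracLaplacian hθ (hψt t)
    set δ : ℝ → UnitAddTorus d → EuclideanSpace ℝ d := fun t x =>
      Torus.timeDeriv ψ t x - ν • Torus.fracLaplacian θ (ψ t) x with hδ_def
    set Bf : ℝ → UnitAddTorus d → (EuclideanSpace ℝ d) →L[ℝ] EuclideanSpace ℝ d := fun t x =>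
      Torus.fderiv (ψ t) x with hBf_def
    have hBs : Torus.IsSmoothSpaceTimeOn univ Bf := hψs.torusFderiv uniqueDiffOn_univ
    have hδc : ∀ t, Continuous (δ t) := fun t =>
      (hψ't t).continuous.sub ((hΛc t).const_smul ν)
    have hBc : ∀ t, Continuous (Bf t) := fun t => (hBs.isSmooth_slice (mem_univ t)).continuous
    have hδst : Continuous (Torus.stLift δ) := by
      have h1 : Continuous (Torus.stLift (Torus.timeDeriv ψ)) := by
        have h := hψ'
        rw [Torus.IsSmoothSpaceTimeOn, univ_prod_univ, contDiffOn_univ] at h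
        exact h.continuous
      have h2 : Continuous (Torus.stLift fun t => Torus.fracLaplacian θ (ψ t)) :=
        Torus.continuous_stLift_fracLaplacian hθ hψs
      exact h1.sub (h2.const_smul ν)
    obtain ⟨Cδ, hCδ⟩ : ∃ C : ℝ, ∀ t ∈ Icc a₁ b₁, ∀ x, ‖δ t x‖ ≤ C :=
      Torus.exists_norm_le_of_continuousOn_of_isCompact (S := univ) hδst.continuousOn
        isCompact_Icc (subset_univ _)
    obtain ⟨CB, hCB⟩ : ∃ C : ℝ, ∀ t ∈ Icc a₁ b₁, ∀ x, ‖Bf t x‖ ≤ C :=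
      hBs.exists_norm_le_of_isCompact isCompact_Icc (subset_univ _)
    -- the integrand in the form of `Torus.lintegral_enorm_momentumFlux_sub_le`
    have hfl : ∀ (a : UnitAddTorus d → EuclideanSpace ℝ d) (t : ℝ) (x : UnitAddTorus d),
        ⟪a x, Torus.timeDeriv ψ t x⟫_ℝ + ⟪a x, Torus.convect a (ψ t) x⟫_ℝ -
            ν * ⟪a x, Torus.fracLaplacian θ (ψ t) x⟫_ℝ =
          ⟪a x, δ t x⟫_ℝ + ⟪a x, Bf t x (a x)⟫_ℝ + 0 * ⟪a x, (0 : EuclideanSpace ℝ d)⟫_ℝ := by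
      intro a t x
      simp only [hδ_def, hBf_def, Torus.convect, inner_sub_right, real_inner_smul_right,
        inner_zero_right, mul_zero, add_zero]
      ring
    -- off the time support of `ψ` all integrands vanish
    have hψ0 : ∀ t, t ∉ Icc a₁ b₁ → (∀ x, Torus.timeDeriv ψ t x = 0) ∧ ψ t = fun _ => 0 := by
      intro t ht
      have h1 : Torus.timeDeriv ψ t = 0 := by
        have h := Torus.iterate_timeDeriv_eq_zero_of_forall_not_mem isClosed_Icc hab 1 t ht
        rwa [Function.iterate_one] at h
      exact ⟨fun x => by rw [h1]; rfl, by rw [hab t ht]; rfl⟩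
    have hzero : ∀ (a : UnitAddTorus d → EuclideanSpace ℝ d) (t : ℝ), t ∉ Icc a₁ b₁ →
        (∫ x, (⟪a x, Torus.timeDeriv ψ t x⟫_ℝ + ⟪a x, Torus.convect a (ψ t) x⟫_ℝ -
          ν * ⟪a x, Torus.fracLaplacian θ (ψ t) x⟫_ℝ)) = 0 := by
      intro a t ht
      obtain ⟨h1, h2⟩ := hψ0 t ht
      have h3 : Torus.fracLaplacian θ (fun _ : UnitAddTorus d => (0 : EuclideanSpace ℝ d)) = 0 :=
        Torus.fracLaplacian_zero_fun θ
      simp [h1, h2, h3, Torus.convect_zero_right]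
    -- the slice integrals
    set F : ℕ → ℝ → ℝ := fun q t => ∫ x, (⟪v q t x, Torus.timeDeriv ψ t x⟫_ℝ +
      ⟪v q t x, Torus.convect (v q t) (ψ t) x⟫_ℝ - ν * ⟪v q t x, Torus.fracLaplacian θ (ψ t) x⟫_ℝ)
      with hF_def
    set G : ℝ → ℝ := fun t => ∫ x, (⟪w t x, Torus.timeDeriv ψ t x⟫_ℝ +
      ⟪w t x, Torus.convect (w t) (ψ t) x⟫_ℝ - ν * ⟪w t x, Torus.fracLaplacian θ (ψ t) x⟫_ℝ)
      with hG_def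
    change ∫ t, G t = 0
    -- (i) the identity with Reynolds defect for each `q`, and the defect tends to zero
    have hFR : ∀ q, ∫ t, F q t = ∫ t, ∫ x, ∑ j, ⟪R q t x j, Torus.partialDeriv j (ψ t) x⟫_ℝ :=
      fun q => (hsol q).weak_identity_line hθ hψ hab hψdiv
    have hKj : ∀ j : d, ∃ K : ℝ, ∀ t ∈ Icc a₁ b₁, ∀ x, ‖Torus.partialDeriv j (ψ t) x‖ ≤ K :=
      fun j => (hψs.partialDeriv uniqueDiffOn_univ j).exists_norm_le_of_isCompact isCompact_Icc
        (subset_univ _)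
    choose K hK using hKj
    set Kt : ℝ := ∑ j, max (K j) 0 with hKt_def
    have hKt0 : 0 ≤ Kt := Finset.sum_nonneg fun j _ => le_max_right _ _
    have hη0 : ∀ q, 0 ≤ η q := fun q =>
      (integral_nonneg fun x => norm_nonneg _).trans (hR q a₁)
    have hRs : ∀ q t, Torus.IsSmooth (R q t) := fun q t =>
      (hsol q).smooth_stress.isSmooth_slice (mem_univ t)
    have hdef_in : ∀ q t, t ∈ Icc a₁ b₁ →
        ‖∫ x, ∑ j, ⟪R q t x j, Torus.partialDeriv j (ψ t) x⟫_ℝ‖ ≤ Kt * η q := by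
      intro q t ht
      have hpt : ∀ x, ‖∑ j, ⟪R q t x j, Torus.partialDeriv j (ψ t) x⟫_ℝ‖ ≤ Kt * ‖R q t x‖ := by
        intro x
        refine (norm_sum_le _ _).trans ?_
        rw [hKt_def, Finset.sum_mul]
        refine Finset.sum_le_sum fun j _ => (norm_inner_le_norm _ _).trans ?_
        rw [mul_comm]
        exact mul_le_mul ((hK j t ht x).trans (le_max_left _ _)) (norm_le_pi_norm (R q t x) j)
          (norm_nonneg _) (le_max_right _ _)
      calc ‖∫ x, ∑ j, ⟪R q t x j, Torus.partialDeriv j (ψ t) x⟫_ℝ‖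
          ≤ ∫ x, Kt * ‖R q t x‖ :=
            norm_integral_le_of_norm_le ((hRs q t).integrable.norm.const_mul Kt)
              (ae_of_all _ hpt)
        _ = Kt * ∫ x, ‖R q t x‖ := integral_const_mul _ _
        _ ≤ Kt * η q := mul_le_mul_of_nonneg_left (hR q t) hKt0
    have hdef_out : ∀ q t, t ∉ Icc a₁ b₁ →
        (∫ x, ∑ j, ⟪R q t x j, Torus.partialDeriv j (ψ t) x⟫_ℝ) = 0 := by
      intro q t ht
      obtain ⟨-, h2⟩ := hψ0 t ht
      have hpd : ∀ (j : d) (x : UnitAddTorus d),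
          Torus.partialDeriv j (fun _ : UnitAddTorus d => (0 : EuclideanSpace ℝ d)) x = 0 := by
        intro j x
        unfold Torus.partialDeriv Torus.lineDeriv
        simp
      simp [h2, hpd]
    have hdef : Tendsto (fun q => ∫ t, F q t) atTop (𝓝 0) := by
      have hvol : volume (Icc a₁ b₁) ≠ ⊤ := measure_Icc_lt_top.ne
      have hbd : ∀ q, ‖∫ t, F q t‖ ≤ (volume (Icc a₁ b₁)).toReal * (Kt * η q) := by
        intro q
        rw [hFR q]
        have hint : Integrable ((Icc a₁ b₁).indicator fun _ : ℝ => Kt * η q) volume :=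
          ((continuousOn_const).integrableOn_compact isCompact_Icc).integrable_indicator
            measurableSet_Icc
        refine (norm_integral_le_of_norm_le hint (ae_of_all _ fun t => ?_)).trans (le_of_eq ?_)
        · by_cases ht : t ∈ Icc a₁ b₁
          · rw [indicator_of_mem ht]
            exact hdef_in q t ht
          · rw [indicator_of_notMem ht, hdef_out q t ht, norm_zero]
        · rw [integral_indicator_const _ measurableSet_Icc, smul_eq_mul, Measure.real]
      have hlim : Tendsto (fun q => (volume (Icc a₁ b₁)).toReal * (Kt * η q)) atTop (𝓝 0) := by
        have h := (hη.const_mul Kt).const_mul (volume (Icc a₁ b₁)).toReal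
        simpa using h
      exact squeeze_zero_norm hbd hlim
    -- (ii) the slice integrals of the approximants are continuous in time
    have hFcont : ∀ q, Continuous (F q) := by
      intro q
      have hv := hsm q
      have hA₁ : ContinuousOn (fun t => ∫ x, (⟪v q t x, Torus.timeDeriv ψ t x⟫_ℝ +
          ⟪v q t x, Torus.convect (v q t) (ψ t) x⟫_ℝ)) univ :=
        ((hv.inner hψ').add (hv.inner (hv.convect hψs uniqueDiffOn_univ))).continuousOn_integral
          convex_univ
      have hA₂ : ContinuousOn (fun t => ∫ x, ⟪v q t x, Torus.fracLaplacian θ (ψ t) x⟫_ℝ) univ :=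
        Torus.continuousOn_integral_inner_fracLaplacian hθ hψs hv.continuousOn_stLift
      have hF' : F q = fun t => (∫ x, (⟪v q t x, Torus.timeDeriv ψ t x⟫_ℝ +
          ⟪v q t x, Torus.convect (v q t) (ψ t) x⟫_ℝ)) -
            ν * ∫ x, ⟪v q t x, Torus.fracLaplacian θ (ψ t) x⟫_ℝ := by
        funext t
        have i12 : Integrable (fun x => ⟪v q t x, Torus.timeDeriv ψ t x⟫_ℝ +
            ⟪v q t x, Torus.convect (v q t) (ψ t) x⟫_ℝ) volume :=
          (((hvs q t).inner (hψ't t)).add ((hvs q t).inner ((hvs q t).convect (hψt t)))).integrable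
        have i3 : Integrable (fun x => ν * ⟪v q t x, Torus.fracLaplacian θ (ψ t) x⟫_ℝ) volume :=
          (((hvs q t).continuous.inner (hΛc t)).integrable_unitAddTorus).const_mul ν
        simp only [hF_def]
        rw [integral_sub i12 i3, integral_const_mul]
      rw [hF']
      exact (continuousOn_univ.1 hA₁).sub ((continuousOn_univ.1 hA₂).const_smul ν)
    -- (iii) pointwise convergence of the slice integrals
    have hlimF : ∀ t, Tendsto (fun q => F q t) atTop (𝓝 (G t)) := by
      intro t
      by_cases ht : t ∈ Icc a₁ b₁
      · have hFq : ∀ q, F q t = ∫ x, (⟪v q t x, δ t x⟫_ℝ + ⟪v q t x, Bf t x (v q t x)⟫_ℝ +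
            0 * ⟪v q t x, (0 : EuclideanSpace ℝ d)⟫_ℝ) := fun q =>
          integral_congr_ae (ae_of_all _ fun x => hfl (v q t) t x)
        have hGt : G t = ∫ x, (⟪w t x, δ t x⟫_ℝ + ⟪w t x, Bf t x (w t x)⟫_ℝ +
            0 * ⟪w t x, (0 : EuclideanSpace ℝ d)⟫_ℝ) :=
          integral_congr_ae (ae_of_all _ fun x => hfl (w t) t x)
        simp_rw [hFq, hGt]
        exact tendsto_integral_flux (fun q => hL2 q t) (hwL2 t) (hδc t) (hBc t) (hCδ t ht)
          (hCB t ht) (hconv t)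
      · have hFq : ∀ q, F q t = 0 := fun q => hzero (v q t) t ht
        have hGt : G t = 0 := hzero (w t) t ht
        simp_rw [hFq, hGt]
        exact tendsto_const_nhds
    -- (iv) domination
    set Kd : ℝ≥0∞ := Torus.momentumBound (ENNReal.ofReal Cδ) (ENNReal.ofReal CB) (ENNReal.ofReal 0) 0
      (Mtot ^ 2) 0 1 with hKd_def
    have hKd : Kd ≠ ⊤ :=
      momentumBound_ne_top ENNReal.ofReal_ne_top ENNReal.ofReal_ne_top ENNReal.ofReal_ne_top
        ENNReal.zero_ne_top ENNReal.zero_ne_top ENNReal.one_ne_top (ENNReal.pow_ne_top hMtot)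
    set bound : ℝ → ℝ := (Icc a₁ b₁).indicator fun _ => Kd.toReal with hbound_def
    have hbound_int : Integrable bound volume :=
      ((continuousOn_const).integrableOn_compact isCompact_Icc).integrable_indicator measurableSet_Icc
    have hbound : ∀ q, ∀ᵐ t, ‖F q t‖ ≤ bound t := by
      intro q
      refine ae_of_all _ fun t => ?_
      by_cases ht : t ∈ Icc a₁ b₁
      · rw [hbound_def, indicator_of_mem ht]
        have hFq : F q t = ∫ x, (⟪v q t x, δ t x⟫_ℝ + ⟪v q t x, Bf t x (v q t x)⟫_ℝ +
            0 * ⟪v q t x, (0 : EuclideanSpace ℝ d)⟫_ℝ) :=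
          integral_congr_ae (ae_of_all _ fun x => hfl (v q t) t x)
        have h1 := enorm_integral_flux_le (hmeas q t) (hCδ t ht) (hCB t ht)
        have h2 : ∫⁻ x, ‖v q t x‖ₑ ^ 2 ≤ Mtot ^ 2 := by
          rw [← eLpNorm_two_sq_eq_lintegral]
          exact pow_le_pow_left' (hvb q t) 2
        have h3 : ‖F q t‖ₑ ≤ Kd := by
          rw [hFq]
          exact h1.trans (momentumBound_mono h2)
        rw [← ofReal_norm] at h3
        exact (ENNReal.ofReal_le_iff_le_toReal hKd).1 h3
      · rw [hbound_def, indicator_of_notMem ht, show F q t = 0 from hzero (v q t) t ht, norm_zero]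
    -- (v) dominated convergence in time and conclusion
    have hDCT : Tendsto (fun q => ∫ t, F q t) atTop (𝓝 (∫ t, G t)) :=
      tendsto_integral_of_dominated_convergence bound (fun q => (hFcont q).aestronglyMeasurable)
        hbound_int hbound (ae_of_all _ hlimF)
    exact tendsto_nhds_unique hDCT hdef

end Limit

end Literature.Barriers.NavierStokesRegularity
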